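import Summits.QuantumFields.YangMills.Theorems.AllWindowsColdBoxBoxHighLineJacWeight

/-!
# T-S5.5J input: the EXACT smeared Faddeev–Popov identity without positivity of the orbit average

For the cold-wall box state `μ = boxState`, an interior-gauge-invariant integrable `F` and a bounded measurable weight `h ≥ 0`
(NO positivity of `N_h` assumed):

  `∫ F · h/N_h dμ = ∫_{N_h ≠ 0} F dμ`     (`x/0 = 0` convention; `N_h ≥ 0` so `N_h ≠ 0 ↔ 0 < N_h`)

— the proof of ✓`smearedFPIdentity` verbatim with `div_self` replaced by `N/N = 1_{N ≠ 0}`.  Instantiated at the Jacobian weight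
`h_J = jacWeight β H r` (✓`…OrbitJacobianDefs`, bounded by ✓`jacWeight_le`, measurable by ✓`measurable_jacWeight`):
`E_box[F · h_J/N_J] = E_box[F ; N_J > 0]` — the representation the STEP-2 packaging (planner ym-idea-2 g18, T-S5.5J «FPRepresentation»,
design note 19:07:07Z: «the exact identity E[F·1_{N_J>0}] = E[F·jacWeight/N_J] needs NO rarity-vs-Z₀ comparison») starts from.
Also the bridge `orbitAverage H h (U^g) = orbitAverage H h U` for a GLOBAL `g` with `IsInteriorGauge H g` (the letters of S4b's representative).

Tree (✓…SmearedFP, ✓…JacWeight) + Mathlib; no definitions; standard axioms.  HONEST LABEL: support lemma of STEP 2 of the XL stub S5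
(LINE-19 ⟨stmt-QuantumFields-24004⟩/⟨24335⟩, U5 ⟨24336⟩); S5/U5 and the route AllWindowsColdBox (DRAFT) remain OPEN; the Yang–Mills mass
gap is NOT proved by this file; no summit is proved by a line.  Seat ym-line-fcl-p3 g25.
-/

set_option autoImplicit false

noncomputable section

open MeasureTheory
open Literature.MathematicalPhysics.QuantumLattice (gaugeTransformZd LGConfig fundamentalRep)
open Literature.Probability.LatticeModels (Site)
open Summit.QuantumFields.YangMills.Theorems.WeakCouplingRates (boxState)

namespace Summit.QuantumFields.YangMills.Theorems.AllWindowsColdBoxBoxHighLine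

namespace FPExact

/-- A global gauge transformation supported on the interior sites IS the extension of its restriction. [folklore] -/
theorem extendGauge_restrict {H : ℕ} {g : Site 4 → SU2} (hg : IsInteriorGauge H g) :
    extendGauge H (fun y : ↥(interiorSites H) => g y) = g := by
  funext x
  unfold extendGauge
  split_ifs with hx
  · rfl
  · exact (hg x hx).symm

/-- The orbit average is invariant under any global gauge transformation supported on the interior sites. [folklore] -/
theorem orbitAverage_gaugeTransformZd_of_isInteriorGauge (H : ℕ) (h : LGConfig 4 SU2 → ℝ) {g : Site 4 → SU2}
    (hg : IsInteriorGauge H g) (U : LGConfig 4 SU2) :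
    orbitAverage H h (gaugeTransformZd g U) = orbitAverage H h U := by
  have := orbitAverage_gaugeTransformZd H h (fun y : ↥(interiorSites H) => g y) U
  rwa [extendGauge_restrict hg] at this

/-- `N/N = 1_{N ≠ 0}` as a real number. -/
theorem div_self_eq_ite (x : ℝ) : x / x = if x = 0 then 0 else 1 := by
  split_ifs with hx
  · rw [hx, div_zero]
  · exact div_self hx

/-- ★ **The exact smeared Faddeev–Popov identity without positivity**: for the cold-wall box state `μ`, an interior-gauge-invariant
integrable `F`, a bounded measurable weight `h ≥ 0`:  `∫ F · h/N_h dμ = ∫ F · 1_{N_h ≠ 0} dμ`. [folklore] -/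
theorem integral_mul_div_orbitAverage_eq (β : ℝ) (H : ℕ) (F h : LGConfig 4 SU2 → ℝ)
    (hF : ∀ g : InteriorGauge H, ∀ U, F (gaugeTransformZd (extendGauge H g) U) = F U)
    (hFi : Integrable F (boxState (fundamentalRep (Fin 2)) β H))
    (hm : Measurable h) (h0 : ∀ U, 0 ≤ h U) (hM : ∃ M : ℝ, ∀ U, h U ≤ M) :
    ∫ U, F U * (h U / orbitAverage H h U) ∂(boxState (fundamentalRep (Fin 2)) β H) =
      ∫ U, F U * (if orbitAverage H h U = 0 then 0 else 1) ∂(boxState (fundamentalRep (Fin 2)) β H) := by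
  obtain ⟨M, hM⟩ := hM
  haveI := isProbabilityMeasure_interiorGaugeMeasure H
  set μ := boxState (fundamentalRep (Fin 2)) β H with hμ
  set π := interiorGaugeMeasure H with hπ
  have hNm : Measurable (orbitAverage H h) := measurable_orbitAverage H hm
  have hN0 : ∀ U, 0 ≤ orbitAverage H h U := fun U => orbitAverage_nonneg (H := H) h0 U
  -- the integrand on the product space
  set Φ : LGConfig 4 SU2 × InteriorGauge H → ℝ :=
    fun p => F p.1 * (h (gaugeTransformZd (extendGauge H p.2) p.1) / orbitAverage H h p.1) with hΦ
  have hΦm : AEStronglyMeasurable Φ (μ.prod π) := by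
    have h1 : AEStronglyMeasurable (fun p : LGConfig 4 SU2 × InteriorGauge H => F p.1) (μ.prod π) :=
      hFi.aestronglyMeasurable.comp_fst
    have h2 : Measurable fun p : LGConfig 4 SU2 × InteriorGauge H =>
        h (gaugeTransformZd (extendGauge H p.2) p.1) / orbitAverage H h p.1 :=
      (hm.comp (measurable_gaugeTransformZd_extendGauge H)).div (hNm.comp measurable_fst)
    exact h1.mul h2.aestronglyMeasurable
  -- inner integrals over the gauge group: `F(U) · N(U)/N(U)`
  have hinner : ∀ U, ∫ k, Φ (U, k) ∂π = F U * (if orbitAverage H h U = 0 then 0 else 1) := by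
    intro U
    simp only [hΦ]
    rw [integral_const_mul, integral_div]
    have : (∫ k, h (gaugeTransformZd (extendGauge H k) U) ∂π) = orbitAverage H h U := rfl
    rw [this, div_self_eq_ite]
  have hnorm : ∀ U, ∫ k, ‖Φ (U, k)‖ ∂π = ‖F U‖ * (if orbitAverage H h U = 0 then 0 else 1) := by
    intro U
    have hk : ∀ k, ‖Φ (U, k)‖ = ‖F U‖ * (h (gaugeTransformZd (extendGauge H k) U) / orbitAverage H h U) := by
      intro k
      simp only [hΦ, norm_mul, Real.norm_eq_abs]
      rw [abs_of_nonneg (div_nonneg (h0 _) (hN0 U))]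
    simp_rw [hk]
    rw [integral_const_mul, integral_div]
    have : (∫ k, h (gaugeTransformZd (extendGauge H k) U) ∂π) = orbitAverage H h U := rfl
    rw [this, div_self_eq_ite]
  -- integrability on the product
  have hint : Integrable Φ (μ.prod π) := by
    rw [integrable_prod_iff hΦm]
    refine ⟨ae_of_all _ fun U => ?_, ?_⟩
    · have hι : Measurable (Prod.mk U : InteriorGauge H → LGConfig 4 SU2 × InteriorGauge H) := measurable_prodMk_left
      have hT := (measurable_gaugeTransformZd_extendGauge H).comp hι
      have hmk : Measurable fun k : InteriorGauge H =>
          F U * (h (gaugeTransformZd (extendGauge H k) U) / orbitAverage H h U) :=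
        measurable_const.mul ((hm.comp hT).div measurable_const)
      simp only [hΦ]
      refine Integrable.of_bound hmk.aestronglyMeasurable (‖F U‖ * (M / orbitAverage H h U))
        (ae_of_all _ fun k => ?_)
      rw [norm_mul, Real.norm_eq_abs, Real.norm_eq_abs, abs_of_nonneg (div_nonneg (h0 _) (hN0 U))]
      exact mul_le_mul_of_nonneg_left (div_le_div_of_nonneg_right (hM _) (hN0 U)) (abs_nonneg _)
    · simp_rw [hnorm]
      refine Integrable.mono' hFi.norm ?_ (ae_of_all _ fun U => ?_)
      · exact (hFi.norm.aestronglyMeasurable.mul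
          ((measurable_const.ite (hNm (measurableSet_singleton 0)) measurable_const).aestronglyMeasurable))
      · rw [Real.norm_eq_abs, abs_mul, abs_norm]
        have : |(if orbitAverage H h U = 0 then (0 : ℝ) else 1)| ≤ 1 := by split_ifs <;> simp
        calc ‖F U‖ * |(if orbitAverage H h U = 0 then (0 : ℝ) else 1)| ≤ ‖F U‖ * 1 :=
              mul_le_mul_of_nonneg_left this (norm_nonneg _)
          _ = ‖F U‖ := mul_one _
  -- for every fixed interior gauge transformation the `U`-integral is the left-hand side
  have hk : ∀ k : InteriorGauge H, ∫ U, Φ (U, k) ∂μ = ∫ U, F U * (h U / orbitAverage H h U) ∂μ := by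
    intro k
    have hmap : μ.map (gaugeTransformZd (extendGauge H k)) = μ := boxStateInteriorGaugeInvariant β H k
    have hφm : AEStronglyMeasurable (fun U => F U * (h U / orbitAverage H h U))
        (μ.map (gaugeTransformZd (extendGauge H k))) := by
      rw [hmap]; exact hFi.aestronglyMeasurable.mul (hm.div hNm).aestronglyMeasurable
    have himap := integral_map (measurable_gaugeTransformZd_su2 (extendGauge H k)).aemeasurable hφm
    rw [hmap] at himap
    rw [himap]
    refine integral_congr_ae (ae_of_all _ fun U => ?_)
    simp only [hΦ, hF k U, orbitAverage_gaugeTransformZd]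
  calc ∫ U, F U * (h U / orbitAverage H h U) ∂μ
      = ∫ k, ∫ U, Φ (U, k) ∂μ ∂π := by simp_rw [hk]; simp
    _ = ∫ U, ∫ k, Φ (U, k) ∂π ∂μ := (integral_integral_swap hint).symm
    _ = ∫ U, F U * (if orbitAverage H h U = 0 then 0 else 1) ∂μ := by simp_rw [hinner]

/-- The same identity in set-integral form: `∫ F · h/N_h dμ = ∫_{0 < N_h} F dμ`. [folklore] -/
theorem integral_mul_div_orbitAverage_eq_setIntegral (β : ℝ) (H : ℕ) (F h : LGConfig 4 SU2 → ℝ)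
    (hF : ∀ g : InteriorGauge H, ∀ U, F (gaugeTransformZd (extendGauge H g) U) = F U)
    (hFi : Integrable F (boxState (fundamentalRep (Fin 2)) β H))
    (hm : Measurable h) (h0 : ∀ U, 0 ≤ h U) (hM : ∃ M : ℝ, ∀ U, h U ≤ M) :
    ∫ U, F U * (h U / orbitAverage H h U) ∂(boxState (fundamentalRep (Fin 2)) β H) =
      ∫ U in {U | 0 < orbitAverage H h U}, F U ∂(boxState (fundamentalRep (Fin 2)) β H) := by
  rw [integral_mul_div_orbitAverage_eq β H F h hF hFi hm h0 hM]
  have hNm : Measurable (orbitAverage H h) := measurable_orbitAverage H hm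
  have hS : MeasurableSet {U : LGConfig 4 SU2 | 0 < orbitAverage H h U} :=
    measurableSet_lt measurable_const hNm
  rw [← integral_indicator hS]
  refine integral_congr_ae (ae_of_all _ fun U => ?_)
  have hN0 : 0 ≤ orbitAverage H h U := orbitAverage_nonneg (H := H) h0 U
  by_cases hU : orbitAverage H h U = 0
  · simp [Set.indicator, hU]
  · have hpos : 0 < orbitAverage H h U := lt_of_le_of_ne hN0 (Ne.symm hU)
    simp [Set.indicator, hU, hpos]

end FPExact

open FPExact

/-- ★ **T-S5.5J, exact part: `E_box[F · h_J/N_J] = E_box[F ; N_J > 0]`** for the Jacobian-weighted FP weight `h_J = jacWeight βw H r`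
(`βw ≥ 0`), every interior-gauge-invariant `boxState`-integrable `F`; no positivity, no window, no rarity. [folklore] -/
theorem integral_mul_jacWeight_div_orbitAverage_eq (β : ℝ) (H : ℕ) {βw : ℝ} (hβw : 0 ≤ βw) (r : ℝ)
    {F : LGConfig 4 SU2 → ℝ} (hF : ∀ g : InteriorGauge H, ∀ U, F (gaugeTransformZd (extendGauge H g) U) = F U)
    (hFi : Integrable F (boxState (fundamentalRep (Fin 2)) β H)) :
    ∫ U, F U * (jacWeight βw H r U / orbitAverage H (jacWeight βw H r) U) ∂(boxState (fundamentalRep (Fin 2)) β H) =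
      ∫ U in {U | 0 < orbitAverage H (jacWeight βw H r) U}, F U ∂(boxState (fundamentalRep (Fin 2)) β H) := by
  obtain ⟨C, _, hle⟩ := jacWeight_le hβw H r
  exact integral_mul_div_orbitAverage_eq_setIntegral β H F (jacWeight βw H r) hF hFi (measurable_jacWeight βw H r)
    (jacWeight_nonneg βw H r) ⟨_, hle⟩

end Summit.QuantumFields.YangMills.Theorems.AllWindowsColdBoxBoxHighLine

end
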